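import Summits.QuantumFields.YangMills.Theorems.SoloInformedU1HelicityGap
import Literature.MathematicalPhysics.QuantumFieldTheory.LatticeGaugeStrongCouplingProofs
import Literature.MathematicalPhysics.QuantumLattice.LatticeGaugeDLRLimitPointsProofs
import HarnessLib

/-!
# QuantumFields / YangMills — saturation of the Gauss-law sum rule under clustering; the helicity gap fails at strong coupling (solo seat `solo-QuantumFields-informed`, s18)

Companion to `SoloInformedU1Helicity.lean` / `SoloInformedU1HelicityGap.lean` (`K1` infrastructure for the abelian
comparison theory; NOT a step towards `YangMills`). Three consequences, all fully proved and using no named facts as hypotheses: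

* `U1Helicity.tendsto_beta_boxVar_div_of_clustering`: in every exponentially clustering infinite-volume limit state
  `μ` of Wilson `U(1)₄` the electric susceptibility per plaquette SATURATES the Gauss-law value,
  `β · #B_N⁻¹ ∫ (∑_{x ∈ B_N} sin θ_{(x;0,1)})² dμ → ⟨cos θ_p⟩_μ` (`N → ∞`) — the positive form of the argument behind
  `abelianMasslessPhaseD4_of_u1HelicityGapD4`.
* `U1Helicity.not_summable_of_gap`, `not_summable_plaqCorr_of_u1HelicityGapD4`: the gap forces the three electric
  two-plaquette functions to be NOT all summable — the Wilson-action, torus-limit-state analogue of the PRINTED conclusion of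
  Fröhlich–Spencer 1982 §2.11 for the Villain action (`FrohlichSpencerVillainMasslessPhotonD4`: "cannot have summable
  fall-off"), which is more than the failure of exponential clustering.
* `u1_boxVar_saturation_strongCoupling`, `u1HelicityGap_fails_strongCoupling`: by the tree's PROVED
  Osterwalder–Seiler strong-coupling theorem (`osterwalder_seiler_strongCoupling_of_secondCountable`, exponential
  clustering of every limit state at `0 ≤ β < β₀`) the saturation holds unconditionally at strong coupling, so the
  inner inequality of `U1HelicityGapD4` is FALSE there: the helicity-gap hypothesis is a genuinely `β`-dependent
  (weak-coupling) statement, neither vacuous nor a tautology. This is also the exact prediction tested by the seat's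
  Monte-Carlo control at `β = 0.5`.
-/

noncomputable section

open MeasureTheory Filter Topology ProbabilityTheory Finset
open Literature.Probability.LatticeModels hiding configShift configShift_apply
open Literature.MathematicalPhysics.QuantumLattice
open Literature.MathematicalPhysics.QuantumFieldTheory hiding IsLocalObservable Site ZdEdge
open Literature.MathematicalPhysics.QuantumFieldTheory.AreaLaw
open Literature.Barriers.QuantumFields

namespace Summit.QuantumFields.YangMills.Theorems

namespace U1Helicity

variable {β : ℝ} {μ : Measure (LGConfig 4 Circle)}

/-- **Saturation under clustering.** If a limit state `μ` of Wilson `U(1)₄` at `β` clusters exponentially on bounded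
measurable gauge-invariant local observables (some rate `m`), then
`β · #B_N⁻¹ ∫ (∑_{x ∈ B_N} sin θ_{(x;0,1)})² dμ → ⟨cos θ_p⟩_μ`: the three electric two-plaquette functions are
summable, the susceptibility sum rule `β ∑_z G(z;0,1) = ⟨cos θ_p⟩` holds, and the Følner limit of the box variances
is `∑_z G(z;0,1)`. -/
theorem tendsto_beta_boxVar_div_of_clustering (hμ : μ ∈ infiniteVolumeLimitPoints (d := 4) u1Rep β)
    {m : ℝ} (hcl : ∀ F₁ F₂ : LGConfig 4 Circle → ℝ,
      Literature.MathematicalPhysics.QuantumLattice.IsLocalObservable F₁ →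
      Literature.MathematicalPhysics.QuantumLattice.IsLocalObservable F₂ →
      Measurable F₁ → Measurable F₂ → (∃ C, ∀ U, |F₁ U| ≤ C) → (∃ C, ∀ U, |F₂ U| ≤ C) →
      IsZdGaugeInvariant F₁ → IsZdGaugeInvariant F₂ →
        HasExponentialDecayRate
          (fun x : Literature.Probability.LatticeModels.Site 4 =>
            cov[F₁, fun U => F₂ (configShift x U); μ]) m) :
    Tendsto (fun N : ℕ => β * (∫ U, (∑ x ∈ box 4 N, u1PlaqIm x 0 1 U) ^ 2 ∂μ) / #(box 4 N)) atTop
      (𝓝 (meanPlaq μ)) := by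
  have h01 := summable_plaqCorr_of_clustering hμ hcl 0 1
  have h12 := summable_plaqCorr_of_clustering hμ hcl 1 2
  have h13 := summable_plaqCorr_of_clustering hμ hcl 1 3
  have h := (tendsto_boxVar_div hμ h01).const_mul β
  rw [beta_mul_tsum_plaqCorr hμ h01 h12 h13] at h
  simpa only [mul_div_assoc] using h

/-- **Fröhlich–Spencer form of the gap's consequence.** In a limit state `μ` of Wilson `U(1)₄` at `β` satisfying the inner
inequality of `U1HelicityGapD4` (a deficit `δ > 0` below the Gauss-law value on all large cubes), the three electric
two-plaquette functions `G(·;0,1)`, `G(·;1,2)`, `G(·;1,3)` are NOT all summable — the Wilson-action, torus-limit-state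
analogue of the printed conclusion of Fröhlich–Spencer 1982 §2.11 for the Villain action ("the two-plaquette correlation
cannot have summable fall-off", vendored as `FrohlichSpencerVillainMasslessPhotonD4`). This is MORE than the failure of
exponential clustering recorded by `abelianMasslessPhaseD4_of_u1HelicityGapD4`. -/
theorem not_summable_of_gap (hμ : μ ∈ infiniteVolumeLimitPoints (d := 4) u1Rep β)
    (hgap : ∃ δ : ℝ, 0 < δ ∧ ∃ N₀ : ℕ, ∀ N : ℕ, N₀ ≤ N →
      β * ∫ U, (∑ x ∈ box 4 N, u1PlaqIm x 0 1 U) ^ 2 ∂μ ≤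
        ((∫ U, ((ZdGaugeConfig.plaquette U 0 0 1 : Circle) : ℂ).re ∂μ) - δ) * #(box 4 N)) :
    ¬ ((Summable fun y => plaqCorr μ y 0 1) ∧ (Summable fun y => plaqCorr μ y 1 2) ∧
        Summable fun y => plaqCorr μ y 1 3) := by
  rintro ⟨h01, h12, h13⟩
  obtain ⟨δ, hδ, N₀, hgap⟩ := hgap
  have h := (tendsto_boxVar_div hμ h01).const_mul β
  rw [beta_mul_tsum_plaqCorr hμ h01 h12 h13] at h
  have hle : meanPlaq μ ≤ meanPlaq μ - δ := by
    refine le_of_tendsto h ?_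
    filter_upwards [eventually_ge_atTop N₀] with N hN
    have hpos : (0 : ℝ) < #(box 4 N) := by exact_mod_cast (box_nonempty 4 N).card_pos
    rw [← mul_div_assoc, div_le_iff₀ hpos]
    exact hgap N hN
  linarith

end U1Helicity

open U1Helicity

/-- **`U1HelicityGapD4` implies the Wilson-action form of Fröhlich–Spencer's masslessness statement** (non-summable electric
two-plaquette correlations in every torus limit state at `β > β₁`). -/
theorem not_summable_plaqCorr_of_u1HelicityGapD4 (h : U1HelicityGapD4) :
    ∃ β₁ : ℝ, ∀ β : ℝ, β₁ < β → ∀ μ ∈ infiniteVolumeLimitPoints (d := 4) u1Rep β,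
      ¬ ((Summable fun y => plaqCorr μ y 0 1) ∧ (Summable fun y => plaqCorr μ y 1 2) ∧
          Summable fun y => plaqCorr μ y 1 3) := by
  obtain ⟨β₁, hβ⟩ := h
  exact ⟨β₁, fun β hβ1 μ hμ => not_summable_of_gap hμ (hβ β hβ1 μ hμ)⟩

/-- **Strong-coupling saturation (unconditional).** There is `β₀ > 0` such that for `0 ≤ β < β₀` every
infinite-volume limit state `μ` of Wilson `U(1)₄` has `β · #B_N⁻¹ ∫ (∑_{x ∈ B_N} sin θ_{(x;0,1)})² dμ → ⟨cos θ_p⟩_μ`.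
Input: the tree's proved Osterwalder–Seiler theorem `osterwalder_seiler_strongCoupling_of_secondCountable` (clause
(iii), exponential clustering) at `G = U(1)`, `ρ = u1Rep`, `d = 4`. -/
theorem u1_boxVar_saturation_strongCoupling :
    ∃ β₀ : ℝ, 0 < β₀ ∧ ∀ β : ℝ, 0 ≤ β → β < β₀ →
      ∀ μ ∈ infiniteVolumeLimitPoints (d := 4) u1Rep β,
        Tendsto (fun N : ℕ => β * (∫ U, (∑ x ∈ box 4 N, u1PlaqIm x 0 1 U) ^ 2 ∂μ) / #(box 4 N)) atTop
          (𝓝 (∫ U, ((ZdGaugeConfig.plaquette U 0 0 1 : Circle) : ℂ).re ∂μ)) := by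
  have hOS := osterwalder_seiler_strongCoupling_of_secondCountable (d := 4) u1Rep
  obtain ⟨β₀, hβ₀, hmain, -⟩ := hOS (by norm_num) continuous_u1Rep
  refine ⟨β₀, hβ₀, fun β h0 hβ μ hμ => ?_⟩
  obtain ⟨-, hμ'⟩ := hmain β h0 hβ
  obtain ⟨-, m, hcl⟩ := hμ' μ hμ
  exact tendsto_beta_boxVar_div_of_clustering hμ hcl

/-- **The helicity gap fails at strong coupling.** For `0 ≤ β < β₀` (the Osterwalder–Seiler threshold) NO limit state
of Wilson `U(1)₄` satisfies the inner inequality of `U1HelicityGapD4`: a uniform deficit `δ > 0` below the Gauss-law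
value is incompatible with the saturation `u1_boxVar_saturation_strongCoupling`. Hence `U1HelicityGapD4` is a genuine
weak-coupling statement (its threshold `β₁` is at least `β₀`), not a vacuous or tautological hypothesis. -/
theorem u1HelicityGap_fails_strongCoupling :
    ∃ β₀ : ℝ, 0 < β₀ ∧ ∀ β : ℝ, 0 ≤ β → β < β₀ →
      ∀ μ ∈ infiniteVolumeLimitPoints (d := 4) u1Rep β,
        ¬ ∃ δ : ℝ, 0 < δ ∧ ∃ N₀ : ℕ, ∀ N : ℕ, N₀ ≤ N →
          β * ∫ U, (∑ x ∈ box 4 N, u1PlaqIm x 0 1 U) ^ 2 ∂μ ≤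
            ((∫ U, ((ZdGaugeConfig.plaquette U 0 0 1 : Circle) : ℂ).re ∂μ) - δ) * #(box 4 N) := by
  obtain ⟨β₀, hβ₀, h⟩ := u1_boxVar_saturation_strongCoupling
  refine ⟨β₀, hβ₀, fun β h0 hβ μ hμ => ?_⟩
  rintro ⟨δ, hδ, N₀, hgap⟩
  have hlim := h β h0 hβ μ hμ
  have hle : (∫ U, ((ZdGaugeConfig.plaquette U 0 0 1 : Circle) : ℂ).re ∂μ) ≤
      (∫ U, ((ZdGaugeConfig.plaquette U 0 0 1 : Circle) : ℂ).re ∂μ) - δ := by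
    refine le_of_tendsto hlim ?_
    filter_upwards [eventually_ge_atTop N₀] with N hN
    have hpos : (0 : ℝ) < #(box 4 N) := by exact_mod_cast (box_nonempty 4 N).card_pos
    rw [div_le_iff₀ hpos]
    exact hgap N hN
  linarith

/-- **The helicity threshold is at least the Osterwalder–Seiler threshold.** If the inner inequality of
`U1HelicityGapD4` holds in every limit state at every `β > β₁`, then `β₀ ≤ β₁` for the strong-coupling threshold `β₀` of
`u1HelicityGap_fails_strongCoupling`: otherwise some `β` with `max(β₁,0) < β < β₀` carries a limit state (tree theorem
`infiniteVolumeLimitPoints_nonempty_holds`, compactness) in which the inequality both holds and fails. -/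
theorem osThreshold_le_helicityThreshold :
    ∃ β₀ : ℝ, 0 < β₀ ∧ ∀ β₁ : ℝ,
      (∀ β : ℝ, β₁ < β → ∀ μ ∈ infiniteVolumeLimitPoints (d := 4) u1Rep β,
        ∃ δ : ℝ, 0 < δ ∧ ∃ N₀ : ℕ, ∀ N : ℕ, N₀ ≤ N →
          β * ∫ U, (∑ x ∈ box 4 N, u1PlaqIm x 0 1 U) ^ 2 ∂μ ≤
            ((∫ U, ((ZdGaugeConfig.plaquette U 0 0 1 : Circle) : ℂ).re ∂μ) - δ) * #(box 4 N)) →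
      β₀ ≤ β₁ := by
  obtain ⟨β₀, hβ₀, hfail⟩ := u1HelicityGap_fails_strongCoupling
  refine ⟨β₀, hβ₀, fun β₁ hgap => ?_⟩
  by_contra hle
  have hlt : β₁ < β₀ := not_le.mp hle
  have hmax : max β₁ 0 < β₀ := max_lt hlt hβ₀
  have hl : β₁ ≤ max β₁ 0 := le_max_left β₁ 0
  have hr : 0 ≤ max β₁ 0 := le_max_right β₁ 0
  obtain ⟨μ, hμ⟩ :=
    infiniteVolumeLimitPoints_nonempty_holds (d := 4) u1Rep continuous_u1Rep ((max β₁ 0 + β₀) / 2)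
  exact hfail ((max β₁ 0 + β₀) / 2) (by linarith) (by linarith) μ hμ
    (hgap ((max β₁ 0 + β₀) / 2) (by linarith) μ hμ)

/-- Corollary: every threshold `β₁` from which the inner inequality of `U1HelicityGapD4` holds is POSITIVE (indeed at
least the Osterwalder–Seiler `β₀ > 0`). -/
theorem u1HelicityGap_threshold_pos (β₁ : ℝ)
    (hgap : ∀ β : ℝ, β₁ < β → ∀ μ ∈ infiniteVolumeLimitPoints (d := 4) u1Rep β,
      ∃ δ : ℝ, 0 < δ ∧ ∃ N₀ : ℕ, ∀ N : ℕ, N₀ ≤ N →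
        β * ∫ U, (∑ x ∈ box 4 N, u1PlaqIm x 0 1 U) ^ 2 ∂μ ≤
          ((∫ U, ((ZdGaugeConfig.plaquette U 0 0 1 : Circle) : ℂ).re ∂μ) - δ) * #(box 4 N)) :
    0 < β₁ := by
  obtain ⟨β₀, hβ₀, h⟩ := osThreshold_le_helicityThreshold
  exact lt_of_lt_of_le hβ₀ (h β₁ hgap)

end Summit.QuantumFields.YangMills.Theorems
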